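import Literature.NumberTheory.Transcendental.RoySmallValueEstimatesEndgameAssemblyProofs
import HarnessLib

/-!
# Route `RoyCriterion`, crux `NguyenRoySmallValueTranslates` (stmt-Schanuel-1051), line `Sketch`
# — stub `stub_degLowerBound`

Registered stub B of the skeleton of line `Sketch` for the crux
`Summit.Schanuel.Schanuel.Theses.RoyCriterion.NguyenRoySmallValueTranslates`, over an abstract
`NguyenRoy.EndgameData σ β ν` (the data entering §6 of Nguyen–Roy 2016). At one level `D`, write
`d = deg Z_D`, `h = h(Z_D)`, `T = ⌊D^σ⌋` and `M = κ D^{ν−β+σ−2} (2D^β d + D h)` (Corollary 16's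
mass). If no point of a class with at least two points has a non-zero translate in the class
(`hnoper`), the index function `ι` is admissible (`0 ≤ ι < T`), Corollary 16's bound holds for
`ι` (`hsum`) and NO point of `Z_D` carries half of it (`hnc`), then
`M < 2 d (c₁₂ d² + 2 d h + 2 c₄ T d² + c₁ T + log 4)`.

Proof.
* `superclose_unique'` (Proposition 12 for the pair of translates `τ^{−i} Z_D`, `τ^{−j} Z_D` at
  the points `τ^{−i} a ≠ τ^{−j} a'`, Lemmas 5 and 11, weak triangle inequality through `γ₀`):
  two distinct points cannot both be super-close to orbit points, quantitatively `pair_cap`: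
  `min(−log dist(a, γ_i), −log dist(a', γ_j)) ≤ c₁₂ d² + 2 d h + 2 c₄ T d² + c₁ T + log 4 =: L`;
  the points `τ^{−i} a`, `τ^{−j} a'` are distinct by `hnoper` (`τ_neg_ne_of_noper`).
* `exists_concentrated'`: under a pairwise cap all the mass beyond `(d − 1) L` sits on one point.
* Hence `M ≤ Σ f ≤ f(a) + (d − 1) L < M/2 + d L`.

## References

* [NguyenRoy2016] N. A. V. Nguyen, D. Roy, IJNT 12 (2016) 1273–1293 = arXiv:1412.5163, §6,
  Proposition 12, Lemmas 5 and 11, Corollary 16.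
-/

-- `Summit.Schanuel.Schanuel.…` is the mandated layout of this single-problem summit (CONVENTIONS §1).
set_option linter.dupNamespace false

noncomputable section

open Filter Finset
open scoped Classical

namespace Summit.Schanuel.Schanuel.Theorems.NguyenRoySharp

open Literature.NumberTheory.Transcendental
open Literature.NumberTheory.Transcendental.NguyenRoy

/-- **Concentration from a pairwise cap.** If a finite family of real "closeness" values has
every PAIR capped (`min ≤ L`), then all the mass beyond `(#s − 1) L` sits on ONE member (the one
of maximal closeness). [folklore] -/
theorem exists_concentrated' {α : Type*} (s : Finset α) (hs : s.Nonempty)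
    (f : α → ℝ) (L : ℝ) (hcap : ∀ a ∈ s, ∀ b ∈ s, a ≠ b → min (f a) (f b) ≤ L) :
    ∃ a ∈ s, ∑ b ∈ s, f b ≤ f a + ((s.card : ℝ) - 1) * L := by
  -- adapted from Cruxes/NguyenRoySmallValueTranslates/Sketch-ideator2-r1.lean
  classical
  obtain ⟨a, ha, hmax⟩ := s.exists_max_image f hs
  refine ⟨a, ha, ?_⟩
  have hothers : ∀ b ∈ s.erase a, f b ≤ L := by
    intro b hb
    have hbs : b ∈ s := Finset.mem_of_mem_erase hb
    have hba : b ≠ a := Finset.ne_of_mem_erase hb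
    have h := hcap a ha b hbs hba.symm
    have : min (f a) (f b) = f b := min_eq_right (hmax b hbs)
    rw [this] at h
    exact h
  have hsum : ∑ b ∈ s, f b = f a + ∑ b ∈ s.erase a, f b := by
    rw [← Finset.add_sum_erase s f ha]
  rw [hsum]
  have hcard : ((s.erase a).card : ℝ) = (s.card : ℝ) - 1 := by
    rw [Finset.card_erase_of_mem ha]
    have : 1 ≤ s.card := Finset.card_pos.mpr hs
    push_cast [Nat.cast_sub this]
    ring
  have := Finset.sum_le_card_nsmul (s.erase a) f L hothers
  rw [nsmul_eq_mul, hcard] at this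
  linarith

section Abstract

variable {σ β ν : ℝ} (E : EndgameData σ β ν)

/-- **Uniqueness of the super-close conjugate** (quantitative form). Two points `a, a'` of the
same zero-dimensional `ℚ`-subvariety `Z` (degree `d`, height `h`) with `τ^{-i} a ≠ τ^{-j} a'`
cannot BOTH be closer to the orbit points `γ_i`, `γ_j` than the same-cycle Liouville cap:
`exp(−(c₁₂ d² + d (h + c₄|j| d) + d (h + c₄|i| d))) ≤ 2 (e^{c₁|i|} dist(a, γ_i) + e^{c₁|j|} dist(a', γ_j))`.
Proof: Proposition 12 (`liouville`) for the pair of translates `τV (-i) Z`, `τV (-j) Z` at the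
points `τ (-i) a`, `τ (-j) a'`, Lemma 11 (`ht_τV_le`), Lemma 5 (`dist_τ_le`) and the weak
triangle inequality through `γ 0`. [cite: NguyenRoy2016, Proposition 12, Lemma 5, Lemma 11] -/
theorem superclose_unique' (Z : E.V) {a a' : E.Pt} (ha : a ∈ E.pts Z) (ha' : a' ∈ E.pts Z)
    (i j : ℤ) (hne : E.τ (-i) a ≠ E.τ (-j) a') :
    Real.exp (-(E.c₁₂ * (E.pts Z).card * (E.pts Z).card
        + (E.pts Z).card * (E.ht Z + E.c₄ * |(j : ℝ)| * (E.pts Z).card)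
        + (E.pts Z).card * (E.ht Z + E.c₄ * |(i : ℝ)| * (E.pts Z).card)))
      ≤ 2 * (Real.exp (E.c₁ * |(i : ℝ)|) * E.dist a (E.γ i)
          + Real.exp (E.c₁ * |(j : ℝ)|) * E.dist a' (E.γ j)) := by
  -- adapted from Cruxes/NguyenRoySmallValueTranslates/Sketch-ideator2-r1.lean
  set b := E.τ (-i) a with hb
  set b' := E.τ (-j) a' with hb'
  have hbm : b ∈ E.pts (E.τV (-i) Z) := E.τ_mem_pts_τV (-i) Z ha
  have hbm' : b' ∈ E.pts (E.τV (-j) Z) := E.τ_mem_pts_τV (-j) Z ha'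
  have hL := E.liouville (E.τV (-i) Z) (E.τV (-j) Z) b hbm b' hbm' hne
  rw [E.card_pts_τV, E.card_pts_τV] at hL
  -- heights of the translates
  have hhi := E.ht_τV_le (-i) Z
  have hhj := E.ht_τV_le (-j) Z
  have habsi : |((-i : ℤ) : ℝ)| = |(i : ℝ)| := by push_cast; rw [abs_neg]
  have habsj : |((-j : ℤ) : ℝ)| = |(j : ℝ)| := by push_cast; rw [abs_neg]
  rw [habsi] at hhi
  rw [habsj] at hhj
  have hd : (0 : ℝ) ≤ (E.pts Z).card := by exact_mod_cast Nat.zero_le _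
  -- compare the two exponents
  have hexp : Real.exp (-(E.c₁₂ * (E.pts Z).card * (E.pts Z).card
        + (E.pts Z).card * (E.ht Z + E.c₄ * |(j : ℝ)| * (E.pts Z).card)
        + (E.pts Z).card * (E.ht Z + E.c₄ * |(i : ℝ)| * (E.pts Z).card)))
      ≤ Real.exp (-(E.c₁₂ * (E.pts Z).card * (E.pts Z).card
        + (E.pts Z).card * E.ht (E.τV (-j) Z) + (E.pts Z).card * E.ht (E.τV (-i) Z))) := by
    apply Real.exp_le_exp.mpr
    have h1 : (E.pts Z).card * E.ht (E.τV (-j) Z)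
        ≤ (E.pts Z).card * (E.ht Z + E.c₄ * |(j : ℝ)| * (E.pts Z).card) :=
      mul_le_mul_of_nonneg_left hhj hd
    have h2 : (E.pts Z).card * E.ht (E.τV (-i) Z)
        ≤ (E.pts Z).card * (E.ht Z + E.c₄ * |(i : ℝ)| * (E.pts Z).card) :=
      mul_le_mul_of_nonneg_left hhi hd
    linarith
  -- distances through γ 0
  have hγi : E.τ (-i) (E.γ i) = E.γ 0 := by rw [E.τ_γ]; simp
  have hγj : E.τ (-j) (E.γ j) = E.γ 0 := by rw [E.τ_γ]; simp
  have hdi : E.dist b (E.γ 0) ≤ Real.exp (E.c₁ * |(i : ℝ)|) * E.dist a (E.γ i) := by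
    have := E.dist_τ_le (-i) a (E.γ i)
    rw [hγi, habsi] at this
    exact this
  have hdj : E.dist b' (E.γ 0) ≤ Real.exp (E.c₁ * |(j : ℝ)|) * E.dist a' (E.γ j) := by
    have := E.dist_τ_le (-j) a' (E.γ j)
    rw [hγj, habsj] at this
    exact this
  have htri : E.dist b b' ≤ 2 * (E.dist b (E.γ 0) + E.dist (E.γ 0) b') := E.dist_triangle _ _ _
  rw [E.dist_comm (E.γ 0) b'] at htri
  calc _ ≤ _ := hexp
    _ ≤ E.dist b b' := hL
    _ ≤ 2 * (E.dist b (E.γ 0) + E.dist b' (E.γ 0)) := htri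
    _ ≤ _ := by nlinarith [hdi, hdj]

/-- **Pairwise cap.** For two points `a, a'` of `Z` (degree `d`, height `h`) with
`τ^{-i} a ≠ τ^{-j} a'` and indices `0 ≤ i, j ≤ T`:
`min(−log dist(a, γ_i), −log dist(a', γ_j)) ≤ c₁₂ d² + 2 d h + 2 c₄ T d² + c₁ T + log 4`
(take logarithms in `superclose_unique'`, bounding its right side by `4 e^{c₁ T} max(dist)`).
[cite: NguyenRoy2016, Proposition 12, Lemma 5, Lemma 11] -/
theorem pair_cap (Z : E.V) {a a' : E.Pt} (ha : a ∈ E.pts Z) (ha' : a' ∈ E.pts Z)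
    {i j : ℤ} {T : ℝ} (hi0 : 0 ≤ i) (hj0 : 0 ≤ j) (hiT : (i : ℝ) ≤ T) (hjT : (j : ℝ) ≤ T)
    (hne : E.τ (-i) a ≠ E.τ (-j) a') :
    min (-Real.log (E.dist a (E.γ i))) (-Real.log (E.dist a' (E.γ j))) ≤
      E.c₁₂ * ((E.pts Z).card : ℝ) ^ 2 + 2 * (E.pts Z).card * E.ht Z
        + 2 * E.c₄ * T * ((E.pts Z).card : ℝ) ^ 2 + E.c₁ * T + Real.log 4 := by
  have hsc := superclose_unique' E Z ha ha' i j hne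
  have hi0' : (0 : ℝ) ≤ i := by exact_mod_cast hi0
  have hj0' : (0 : ℝ) ≤ j := by exact_mod_cast hj0
  rw [abs_of_nonneg hi0', abs_of_nonneg hj0'] at hsc
  set d : ℝ := ((E.pts Z).card : ℝ) with hd
  set h : ℝ := E.ht Z with hh
  have hd0 : 0 ≤ d := Nat.cast_nonneg _
  have hc4 := E.c₄_nonneg
  have hc1 := E.c₁_nonneg
  set L₀ : ℝ := E.c₁₂ * d ^ 2 + 2 * d * h + 2 * E.c₄ * T * d ^ 2 with hL₀
  -- the exponent of `superclose_unique'` is at least `-L₀`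
  have hexp : Real.exp (-L₀) ≤ Real.exp (-(E.c₁₂ * d * d + d * (h + E.c₄ * j * d)
      + d * (h + E.c₄ * i * d))) := by
    apply Real.exp_le_exp.mpr
    have h1 : E.c₄ * i * d ≤ E.c₄ * T * d :=
      mul_le_mul_of_nonneg_right (mul_le_mul_of_nonneg_left hiT hc4) hd0
    have h2 : E.c₄ * j * d ≤ E.c₄ * T * d :=
      mul_le_mul_of_nonneg_right (mul_le_mul_of_nonneg_left hjT hc4) hd0
    have h3 : d * (E.c₄ * i * d) ≤ d * (E.c₄ * T * d) := mul_le_mul_of_nonneg_left h1 hd0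
    have h4 : d * (E.c₄ * j * d) ≤ d * (E.c₄ * T * d) := mul_le_mul_of_nonneg_left h2 hd0
    rw [hL₀]
    nlinarith [h3, h4]
  -- its right side is at most `2 e^{c₁ T} (dist a + dist a')`
  have hei : Real.exp (E.c₁ * i) ≤ Real.exp (E.c₁ * T) :=
    Real.exp_le_exp.mpr (mul_le_mul_of_nonneg_left hiT hc1)
  have hej : Real.exp (E.c₁ * j) ≤ Real.exp (E.c₁ * T) :=
    Real.exp_le_exp.mpr (mul_le_mul_of_nonneg_left hjT hc1)
  have hda : 0 < E.dist a (E.γ i) := E.dist_γ_pos Z a ha i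
  have hda' : 0 < E.dist a' (E.γ j) := E.dist_γ_pos Z a' ha' j
  have heT := Real.exp_pos (E.c₁ * T)
  have key : Real.exp (-L₀) ≤
      2 * Real.exp (E.c₁ * T) * (E.dist a (E.γ i) + E.dist a' (E.γ j)) := by
    have i1 := mul_le_mul_of_nonneg_right hei hda.le
    have i2 := mul_le_mul_of_nonneg_right hej hda'.le
    calc Real.exp (-L₀) ≤ _ := hexp
      _ ≤ _ := hsc
      _ ≤ _ := by linarith
  -- taking logarithms
  have main : ∀ δ : ℝ, 0 < δ → Real.exp (-L₀) ≤ 4 * Real.exp (E.c₁ * T) * δ →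
      -Real.log δ ≤ L₀ + E.c₁ * T + Real.log 4 := by
    intro δ hδ hle
    have h1 : Real.exp (-L₀) ≤ Real.exp (Real.log 4 + E.c₁ * T + Real.log δ) := by
      rw [Real.exp_add, Real.exp_add, Real.exp_log (by norm_num : (0 : ℝ) < 4), Real.exp_log hδ]
      exact hle
    have h2 := Real.exp_le_exp.mp h1
    linarith
  rcases le_total (E.dist a (E.γ i)) (E.dist a' (E.γ j)) with hle | hle
  · have i1 := mul_le_mul_of_nonneg_left hle heT.le
    have h1 := main _ hda' (by linarith)
    calc min (-Real.log (E.dist a (E.γ i))) (-Real.log (E.dist a' (E.γ j)))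
        ≤ -Real.log (E.dist a' (E.γ j)) := min_le_right _ _
      _ ≤ _ := by rw [hL₀] at h1; linarith
  · have i1 := mul_le_mul_of_nonneg_left hle heT.le
    have h1 := main _ hda (by linarith)
    calc min (-Real.log (E.dist a (E.γ i))) (-Real.log (E.dist a' (E.γ j)))
        ≤ -Real.log (E.dist a (E.γ i)) := min_le_left _ _
      _ ≤ _ := by rw [hL₀] at h1; linarith

/-- **Distinctness of the recentred points.** If no point of a class with at least two points
has a non-zero translate in the class, then for two distinct points `a ≠ a'` of `Z` and any
`i, j`, `τ^{-i} a ≠ τ^{-j} a'` (otherwise `a' = τ^{j−i} a`, so either `j = i` and `a' = a`, or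
`τ^{j−i} a ∈ Z` with `j − i ≠ 0`). [cite: NguyenRoy2016, §5, proof of Proposition 14] -/
theorem τ_neg_ne_of_noper
    (hnoper : ∀ Z : E.V, 2 ≤ (E.pts Z).card → ∀ a ∈ E.pts Z, ∀ k : ℤ, k ≠ 0 → E.τ k a ∉ E.pts Z)
    (Z : E.V) {a a' : E.Pt} (ha : a ∈ E.pts Z) (ha' : a' ∈ E.pts Z) (hne : a ≠ a') (i j : ℤ) :
    E.τ (-i) a ≠ E.τ (-j) a' := by
  intro h
  have h2 : 2 ≤ (E.pts Z).card := Finset.one_lt_card.mpr ⟨a, ha, a', ha', hne⟩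
  have key : E.τ (j + -i) a = a' := by
    have h' := congrArg (E.τ j) h
    rwa [E.τ_τ, E.τ_τ_neg] at h'
  by_cases hk : j + -i = 0
  · rw [hk, E.τ_zero] at key
    exact hne key
  · exact hnoper Z h2 a ha (j + -i) hk (key ▸ ha')

/-- **Stub B — non-concentration forces a large degree (self-Liouville pairwise cap).** At one
level `D`: if no point of a class with `≥ 2` points has a non-zero translate in the class
(`hnoper`), `ι` is admissible, Corollary 16's bound holds for `ι`, and NO point carries half of it,
then `κ D^{ν−β+σ−2}(2D^β deg + D ht) < 2 deg (c₁₂ deg² + 2 deg ht + 2c₄ ⌊D^σ⌋ deg² + c₁ ⌊D^σ⌋ + log 4)`.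
Proof: the pairwise cap `pair_cap` (Prop. 12 = `E.liouville` for `τ^{-ιa} Z_D`, `τ^{-ιa'} Z_D`
at the points `τ^{-ιa} a ≠ τ^{-ιa'} a'` — distinct by `hnoper` — plus Lemmas 5, 11 and the weak
triangle inequality through `γ₀`) and `exists_concentrated'` (the mass beyond `(deg−1)·cap` sits
on one point), against `hsum` and `hnc`. [cite: NguyenRoy2016, Proposition 12, Lemma 5, Lemma 11] -/
theorem stub_degLowerBound
    (hnoper : ∀ Z : E.V, 2 ≤ (E.pts Z).card → ∀ a ∈ E.pts Z, ∀ k : ℤ, k ≠ 0 → E.τ k a ∉ E.pts Z)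
    {D : ℕ} {ι : E.Pt → ℤ}
    (hι : ∀ a ∈ E.pts (E.Z D), 0 ≤ ι a ∧ ι a < (⌊(D : ℝ) ^ σ⌋₊ : ℕ))
    (hsum : ∑ a ∈ E.pts (E.Z D), ((D : ℝ) ^ β + Real.log (E.dist a (E.γ (ι a)))) ≤
      -(E.κ * (D : ℝ) ^ (ν - β + σ - 2) *
        (2 * (D : ℝ) ^ β * (E.pts (E.Z D)).card + D * E.ht (E.Z D))))
    (hnc : ∀ a ∈ E.pts (E.Z D),
      -(E.κ / 2 * (D : ℝ) ^ (ν - β + σ - 2) *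
          (2 * (D : ℝ) ^ β * (E.pts (E.Z D)).card + D * E.ht (E.Z D))) <
        (D : ℝ) ^ β + Real.log (E.dist a (E.γ (ι a)))) :
    E.κ * (D : ℝ) ^ (ν - β + σ - 2) *
        (2 * (D : ℝ) ^ β * (E.pts (E.Z D)).card + D * E.ht (E.Z D)) <
      2 * (E.pts (E.Z D)).card *
        (E.c₁₂ * ((E.pts (E.Z D)).card : ℝ) ^ 2 + 2 * (E.pts (E.Z D)).card * E.ht (E.Z D) +
          2 * E.c₄ * ⌊(D : ℝ) ^ σ⌋₊ * ((E.pts (E.Z D)).card : ℝ) ^ 2 + E.c₁ * ⌊(D : ℝ) ^ σ⌋₊ +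
          Real.log 4) := by
  -- abbreviations
  set S := E.pts (E.Z D) with hS
  set T : ℕ := ⌊(D : ℝ) ^ σ⌋₊ with hT
  set L : ℝ := E.c₁₂ * (S.card : ℝ) ^ 2 + 2 * S.card * E.ht (E.Z D) +
    2 * E.c₄ * T * (S.card : ℝ) ^ 2 + E.c₁ * T + Real.log 4 with hL
  set f : E.Pt → ℝ := fun a => -((D : ℝ) ^ β + Real.log (E.dist a (E.γ (ι a)))) with hf
  -- `0 ≤ L`
  have hd0 : (0 : ℝ) ≤ S.card := Nat.cast_nonneg _
  have hT0 : (0 : ℝ) ≤ T := Nat.cast_nonneg _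
  have hh0 := E.ht_nonneg (E.Z D)
  have hlog4 : 0 < Real.log 4 := Real.log_pos (by norm_num)
  have hL0 : 0 ≤ L := by
    have i1 : 0 ≤ E.c₁₂ * (S.card : ℝ) ^ 2 := mul_nonneg E.c₁₂_nonneg (sq_nonneg _)
    have i2 : 0 ≤ 2 * (S.card : ℝ) * E.ht (E.Z D) := by positivity
    have i3 : 0 ≤ 2 * E.c₄ * T * (S.card : ℝ) ^ 2 :=
      mul_nonneg (mul_nonneg (mul_nonneg (by norm_num) E.c₄_nonneg) hT0) (sq_nonneg _)
    have i4 : 0 ≤ E.c₁ * T := mul_nonneg E.c₁_nonneg hT0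
    rw [hL]
    linarith
  -- the pairwise cap for the closeness `f`
  have hDβ : 0 ≤ (D : ℝ) ^ β := by positivity
  have hcap : ∀ a ∈ S, ∀ b ∈ S, a ≠ b → min (f a) (f b) ≤ L := by
    intro a ha b hb hab
    obtain ⟨hi0, hiT⟩ := hι a ha
    obtain ⟨hj0, hjT⟩ := hι b hb
    have hne := τ_neg_ne_of_noper E hnoper (E.Z D) ha hb hab (ι a) (ι b)
    have hiT' : ((ι a : ℤ) : ℝ) ≤ (T : ℝ) := by exact_mod_cast hiT.le
    have hjT' : ((ι b : ℤ) : ℝ) ≤ (T : ℝ) := by exact_mod_cast hjT.le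
    have hc := pair_cap E (E.Z D) ha hb hi0 hj0 hiT' hjT' hne
    calc min (f a) (f b)
        ≤ min (-Real.log (E.dist a (E.γ (ι a)))) (-Real.log (E.dist b (E.γ (ι b)))) := by
          apply min_le_min
          · simp only [hf]; linarith
          · simp only [hf]; linarith
      _ ≤ L := by rw [hL]; exact hc
  -- concentration on one point `a`
  obtain ⟨a, ha, hconc⟩ := exists_concentrated' S (E.pts_nonempty _) f L hcap
  have hsumf : ∑ b ∈ S, f b = -∑ b ∈ S, ((D : ℝ) ^ β + Real.log (E.dist b (E.γ (ι b)))) := by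
    simp only [hf, Finset.sum_neg_distrib]
  have h1 : E.κ * (D : ℝ) ^ (ν - β + σ - 2) * (2 * (D : ℝ) ^ β * S.card + D * E.ht (E.Z D)) ≤
      ∑ b ∈ S, f b := by
    rw [hsumf]
    linarith
  have h2 : f a < E.κ / 2 * (D : ℝ) ^ (ν - β + σ - 2) *
      (2 * (D : ℝ) ^ β * S.card + D * E.ht (E.Z D)) := by
    have := hnc a ha
    simp only [hf]
    linarith
  have h3 : ((S.card : ℝ) - 1) * L ≤ S.card * L := by nlinarith
  rw [hL] at hconc h3
  linarith

end Abstract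

end Summit.Schanuel.Schanuel.Theorems.NguyenRoySharp

end
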